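import Literature.NumberTheory.ZetaValues.CohenRivoalMarkovWZPair
import HarnessLib

/-!
# Majorants for the Cohen–Rivoal Markov–WZ kernel (boundary terms of Hessami Pilehrood 2008, §2)

Topic `Literature/NumberTheory/ZetaValues`. In [HessamiPilehrood2008MarkovWZ, §2] the boundary terms of the WZ summation
(`lim_n Σ_k F(n,k) = 0`, `lim_k Σ_n G(n,k) = 0`) are disposed of by a growth estimate ((lr), via Poincaré's theorem on the
recurrence for `L(n)`); for the explicit pair of `CohenRivoalMarkovWZPair.lean` (`L ≡ 0`) the following two elementary
majorants do the same job and are what `CohenRivoalProofs.lean` uses. With `ρ = ‖a‖² + ‖b‖⁴ < 1`,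
`P(m) = m⁴ − a²m² − b⁴`, `R(m) = (m²−a²)² + 4b⁴`, `κ_n = (−1)ⁿ n! ∏_{m≤n} R(m)/(2^{n+1} ∏_{m≤n}(2m+1))`:
* `cohenRivoal_norm_hprod_inv_le`: `‖(∏_{m=k+1}^{n+k+1} P(m))⁻¹‖ ≤ (2/(1−ρ)) (k!/(n+k+1)!)⁴` — from
  `‖P(m)‖ ≥ m⁴(1 − ρ/m²)`
  and `∏_m (1 − ρ/m²) ≥ (1−ρ) ∏_{m≥2} (1 − 1/m²) ≥ (1−ρ)/2` (the product telescopes to `(M+1)/(2M)`);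
* `cohenRivoal_norm_kappa_le`: `‖κ_n‖ ≤ e¹⁴ n!⁶/(2(2n+1)!)` — from `‖R(m)‖ ≤ m⁴(1 + 7/m²)`, `1 + x ≤ eˣ`, `Σ m⁻² ≤ 2`.
Together: `‖κ_n‖ ‖H(n,k)‖ ≤ (2e¹⁴/(1−ρ)) · n!⁶k!⁴/(2(2n+1)!((n+k+1)!)⁴)`, a constant times the real kernel of
`AlmkvistGranvilleZetaSevenProofs.lean`.
-/

open Finset

noncomputable section

namespace Literature.NumberTheory.ZetaValues

/-- `∏_{j<J} (1 − 1/(j+2)²) = (J+2)/(2(J+1)) ≥ ½` (telescoping). [folklore] -/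
private theorem prod_one_sub_inv_sq (J : ℕ) :
    ∏ j ∈ range J, (1 - 1 / ((j : ℝ) + 2) ^ 2) = ((J : ℝ) + 2) / (2 * ((J : ℝ) + 1)) := by
  induction J with
  | zero => norm_num
  | succ J ih =>
    rw [prod_range_succ, ih]
    push_cast
    have h1 : (J : ℝ) + 1 ≠ 0 := by positivity
    have h2 : (J : ℝ) + 2 ≠ 0 := by positivity
    have h3 : (J : ℝ) + 1 + 2 ≠ 0 := by positivity
    have h4 : (J : ℝ) + 1 + 1 ≠ 0 := by positivity
    field_simp
    ring

/-- For `0 ≤ ρ ≤ 1`: `∏_{i<N} (1 − ρ/(k+1+i)²) ≥ (1−ρ)/2` (a block of the convergent product `∏_m (1 − ρ/m²)`).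
[folklore] -/
private theorem block_prod_ge {ρ : ℝ} (hρ0 : 0 ≤ ρ) (hρ1 : ρ ≤ 1) (k N : ℕ) :
    (1 - ρ) / 2 ≤ ∏ i ∈ range N, (1 - ρ / ((k : ℝ) + 1 + i) ^ 2) := by
  -- the full product from `m = 1`
  have hfac : ∀ m : ℕ, 0 ≤ 1 - ρ / ((m : ℝ) + 1) ^ 2 ∧ 1 - ρ / ((m : ℝ) + 1) ^ 2 ≤ 1 := fun m => by
    have hm : (1 : ℝ) ≤ ((m : ℝ) + 1) ^ 2 := by nlinarith [(m.cast_nonneg : (0 : ℝ) ≤ m)]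
    constructor
    · rw [sub_nonneg, div_le_one (by positivity)]; linarith
    · have : 0 ≤ ρ / ((m : ℝ) + 1) ^ 2 := by positivity
      linarith
  have hfull : ∀ M : ℕ, (1 - ρ) / 2 ≤ ∏ m ∈ range M, (1 - ρ / ((m : ℝ) + 1) ^ 2) := by
    intro M
    cases M with
    | zero => simp; linarith
    | succ J =>
      rw [prod_range_succ']
      push_cast
      simp only [zero_add, one_pow, div_one]
      have h1 : (1 : ℝ) / 2 ≤ ∏ j ∈ range J, (1 - ρ / ((j : ℝ) + 1 + 1) ^ 2) := by
        calc (1 : ℝ) / 2 ≤ ((J : ℝ) + 2) / (2 * ((J : ℝ) + 1)) := by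
              rw [div_le_div_iff₀ (by norm_num) (by positivity)]; linarith [(J.cast_nonneg : (0 : ℝ) ≤ J)]
          _ = ∏ j ∈ range J, (1 - 1 / ((j : ℝ) + 2) ^ 2) := (prod_one_sub_inv_sq J).symm
          _ ≤ ∏ j ∈ range J, (1 - ρ / ((j : ℝ) + 1 + 1) ^ 2) := by
              refine prod_le_prod (fun j _ => ?_) fun j _ => ?_
              · rw [sub_nonneg, div_le_one (by positivity)]; nlinarith [(j.cast_nonneg : (0 : ℝ) ≤ j)]
              · rw [show (j : ℝ) + 1 + 1 = (j : ℝ) + 2 by ring]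
                gcongr
      calc (1 - ρ) / 2 = 1 / 2 * (1 - ρ) := by ring
        _ ≤ (∏ j ∈ range J, (1 - ρ / ((j : ℝ) + 1 + 1) ^ 2)) * (1 - ρ) :=
            mul_le_mul_of_nonneg_right h1 (by linarith)
  -- the block is at least the full product
  have hsplit := prod_range_add (fun m : ℕ => 1 - ρ / ((m : ℝ) + 1) ^ 2) k N
  have hA1 : ∏ m ∈ range k, (1 - ρ / ((m : ℝ) + 1) ^ 2) ≤ 1 := prod_le_one (fun m _ => (hfac m).1) fun m _ => (hfac m).2
  have hB0 : 0 ≤ ∏ i ∈ range N, (1 - ρ / ((k : ℝ) + 1 + i) ^ 2) :=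
    prod_nonneg fun i _ => by
      have := (hfac (k + i)).1; push_cast at this; rw [show (k : ℝ) + 1 + i = (k : ℝ) + i + 1 by ring]; exact this
  have e : ∏ x ∈ range N, (1 - ρ / (((k + x : ℕ) : ℝ) + 1) ^ 2) = ∏ i ∈ range N, (1 - ρ / ((k : ℝ) + 1 + i) ^ 2) :=
    prod_congr rfl fun i _ => by push_cast; ring_nf
  rw [e] at hsplit
  calc (1 - ρ) / 2 ≤ ∏ m ∈ range (k + N), (1 - ρ / ((m : ℝ) + 1) ^ 2) := hfull (k + N)
    _ = _ := hsplit
    _ ≤ 1 * ∏ i ∈ range N, (1 - ρ / ((k : ℝ) + 1 + i) ^ 2) := by gcongr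
    _ = _ := one_mul _

/-- `Σ_{m<n} 1/(m+1)² ≤ 2`. [folklore] -/
private theorem harm_two_le (n : ℕ) : ∑ m ∈ range n, 1 / ((m : ℝ) + 1) ^ 2 ≤ 2 := by
  have h : ∀ n : ℕ, ∑ m ∈ range (n + 1), 1 / ((m : ℝ) + 1) ^ 2 ≤ 2 - 1 / ((n : ℝ) + 1) := by
    intro n
    induction n with
    | zero => norm_num
    | succ n ih =>
      rw [sum_range_succ]
      push_cast
      have h1 : 1 / (((n : ℝ) + 1 + 1) ^ 2) ≤ 1 / ((n : ℝ) + 1) - 1 / ((n : ℝ) + 1 + 1) := by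
        rw [div_sub_div _ _ (by positivity) (by positivity), div_le_div_iff₀ (by positivity) (by positivity)]
        nlinarith [(n.cast_nonneg : (0 : ℝ) ≤ n)]
      linarith
  calc ∑ m ∈ range n, 1 / ((m : ℝ) + 1) ^ 2 ≤ ∑ m ∈ range (n + 1), 1 / ((m : ℝ) + 1) ^ 2 :=
        sum_le_sum_of_subset_of_nonneg (Finset.range_mono (Nat.le_succ n)) fun m _ _ => by positivity
    _ ≤ 2 := (h n).trans (by linarith [(by positivity : (0 : ℝ) < 1 / ((n : ℝ) + 1))])

/-- `2ⁿ n! ∏_{m<n} (2m+3) = (2n+1)!` over `ℝ`. [folklore] -/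
private theorem two_pow_mul_factorial_mul_prod_odd_real (n : ℕ) :
    (2 : ℝ) ^ n * (n.factorial : ℝ) * ∏ m ∈ range n, (2 * ((m : ℝ) + 1) + 1) = ((2 * n + 1).factorial : ℝ) := by
  induction n with
  | zero => simp
  | succ n ih =>
    rw [prod_range_succ, Nat.factorial_succ, show 2 * (n + 1) + 1 = (2 * n + 1) + 1 + 1 by ring,
      Nat.factorial_succ (2 * n + 1 + 1), Nat.factorial_succ (2 * n + 1)]
    push_cast
    linear_combination (2 * ((n : ℝ) + 1) * (2 * (n : ℝ) + 3)) * ih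

/-- `k! ∏_{i<n+1} (k+1+i) = (n+k+1)!` over `ℝ`. [folklore] -/
private theorem factorial_mul_prod_range_real (n k : ℕ) :
    (k.factorial : ℝ) * ∏ i ∈ range (n + 1), ((k : ℝ) + 1 + i) = ((n + k + 1).factorial : ℝ) := by
  have h := Nat.factorial_mul_ascFactorial k (n + 1)
  rw [Nat.ascFactorial_eq_prod_range, show k + (n + 1) = n + k + 1 by ring] at h
  exact_mod_cast h

/-- **The kernel's denominator** (an elementary majorant behind the vanishing of the boundary terms in
[HessamiPilehrood2008MarkovWZ, §2, after (lr)]): for `ρ = ‖a‖² + ‖b‖⁴ < 1`,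
`‖(∏_{i≤n} P(k+1+i))⁻¹‖ ≤ (2/(1−ρ)) · (k!/(n+k+1)!)⁴`, from `‖P(m)‖ ≥ m⁴(1 − ρ/m²)` and the telescoping bound
`∏(1 − ρ/m²) ≥ (1−ρ)/2`. [cite: HessamiPilehrood2008MarkovWZ, §2 (boundary terms: lim Σ_k F(n,k) = 0, lim Σ_n G(n,k) = 0)] -/
theorem cohenRivoal_norm_hprod_inv_le {a b : ℂ} (hab : ‖a‖ ^ 2 + ‖b‖ ^ 4 < 1) (n k : ℕ) :
    ‖(∏ i ∈ range (n + 1), (((k : ℂ) + 1 + i) ^ 4 - a ^ 2 * ((k : ℂ) + 1 + i) ^ 2 - b ^ 4))⁻¹‖ ≤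
      2 / (1 - (‖a‖ ^ 2 + ‖b‖ ^ 4)) * ((k.factorial : ℝ) / ((n + k + 1).factorial : ℝ)) ^ 4 := by
  set ρ : ℝ := ‖a‖ ^ 2 + ‖b‖ ^ 4 with hρ
  have hρ0 : 0 ≤ ρ := by positivity
  -- each factor: `‖P(x)‖ ≥ x⁴ (1 − ρ/x²)`
  have hfac : ∀ i : ℕ, ((k : ℝ) + 1 + i) ^ 4 * (1 - ρ / ((k : ℝ) + 1 + i) ^ 2) ≤
      ‖(((k : ℂ) + 1 + i) ^ 4 - a ^ 2 * ((k : ℂ) + 1 + i) ^ 2 - b ^ 4)‖ := by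
    intro i
    have hx : (1 : ℝ) ≤ (k : ℝ) + 1 + i := by linarith [(k.cast_nonneg : (0 : ℝ) ≤ k), (i.cast_nonneg : (0 : ℝ) ≤ i)]
    have h := cohenRivoal_norm_P_ge a b hx
    have e : ((((k : ℝ) + 1 + i : ℝ)) : ℂ) = (k : ℂ) + 1 + i := by push_cast; ring
    rw [e] at h
    have hx0 : ((k : ℝ) + 1 + i) ≠ 0 := by positivity
    calc ((k : ℝ) + 1 + i) ^ 4 * (1 - ρ / ((k : ℝ) + 1 + i) ^ 2)
        = ((k : ℝ) + 1 + i) ^ 2 * (((k : ℝ) + 1 + i) ^ 2 - ρ) := by field_simp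
      _ ≤ _ := h
  have hfac0 : ∀ i : ℕ, 0 ≤ ((k : ℝ) + 1 + i) ^ 4 * (1 - ρ / ((k : ℝ) + 1 + i) ^ 2) := fun i => by
    have hx : (1 : ℝ) ≤ ((k : ℝ) + 1 + i) ^ 2 := by nlinarith [(k.cast_nonneg : (0 : ℝ) ≤ k), (i.cast_nonneg : (0 : ℝ) ≤ i)]
    refine mul_nonneg (by positivity) ?_
    rw [sub_nonneg, div_le_one (by positivity)]; linarith
  -- the product
  have hprod : ((1 - ρ) / 2) * (((n + k + 1).factorial : ℝ) / (k.factorial : ℝ)) ^ 4 ≤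
      ‖∏ i ∈ range (n + 1), (((k : ℂ) + 1 + i) ^ 4 - a ^ 2 * ((k : ℂ) + 1 + i) ^ 2 - b ^ 4)‖ := by
    rw [norm_prod]
    have hq : (((n + k + 1).factorial : ℝ) / (k.factorial : ℝ)) = ∏ i ∈ range (n + 1), ((k : ℝ) + 1 + i) := by
      rw [div_eq_iff (by positivity), mul_comm, factorial_mul_prod_range_real]
    calc (1 - ρ) / 2 * ((((n + k + 1).factorial : ℝ)) / (k.factorial : ℝ)) ^ 4
        ≤ (∏ i ∈ range (n + 1), (1 - ρ / ((k : ℝ) + 1 + i) ^ 2)) * (∏ i ∈ range (n + 1), ((k : ℝ) + 1 + i)) ^ 4 := by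
          rw [hq]; gcongr; exact block_prod_ge hρ0 hab.le k (n + 1)
      _ = ∏ i ∈ range (n + 1), (((k : ℝ) + 1 + i) ^ 4 * (1 - ρ / ((k : ℝ) + 1 + i) ^ 2)) := by
          rw [prod_mul_distrib, prod_pow, mul_comm]
      _ ≤ _ := prod_le_prod (fun i _ => hfac0 i) fun i _ => hfac i
  have hpos : 0 < ((1 - ρ) / 2) * (((n + k + 1).factorial : ℝ) / (k.factorial : ℝ)) ^ 4 :=
    mul_pos (by linarith) (by positivity)
  rw [norm_inv]
  calc ‖∏ i ∈ range (n + 1), (((k : ℂ) + 1 + i) ^ 4 - a ^ 2 * ((k : ℂ) + 1 + i) ^ 2 - b ^ 4)‖⁻¹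
      ≤ (((1 - ρ) / 2) * (((n + k + 1).factorial : ℝ) / (k.factorial : ℝ)) ^ 4)⁻¹ :=
        inv_anti₀ hpos hprod
    _ = 2 / (1 - ρ) * ((k.factorial : ℝ) / ((n + k + 1).factorial : ℝ)) ^ 4 := by
        have h1 : (1 - ρ) ≠ 0 := by linarith
        have h2 : (k.factorial : ℝ) ≠ 0 := by positivity
        have h3 : ((n + k + 1).factorial : ℝ) ≠ 0 := by positivity
        field_simp

/-- **The kernel's numerator** (an elementary majorant behind the vanishing of the boundary terms in
[HessamiPilehrood2008MarkovWZ, §2]): for `‖a‖² + ‖b‖⁴ < 1`, `‖κ_n‖ ≤ e¹⁴ · n!⁶/(2 (2n+1)!)`, from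
`‖(m²−a²)²+4b⁴‖ ≤ m⁴(1 + 7/m²)`, `∏ (1 + 7/m²) ≤ exp(7 Σ m⁻²) ≤ e¹⁴` and `2ⁿ n! ∏_{m≤n}(2m+1) = (2n+1)!`.
[cite: HessamiPilehrood2008MarkovWZ, §2 (boundary terms: lim Σ_k F(n,k) = 0, lim Σ_n G(n,k) = 0)] -/
theorem cohenRivoal_norm_kappa_le {a b : ℂ} (hab : ‖a‖ ^ 2 + ‖b‖ ^ 4 < 1) (n : ℕ) :
    ‖(-1 : ℂ) ^ n * (n.factorial : ℂ) / 2 ^ (n + 1) *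
        ∏ m ∈ range n, ((((m : ℂ) + 1) ^ 2 - a ^ 2) ^ 2 + 4 * b ^ 4) / (2 * ((m : ℂ) + 1) + 1)‖ ≤
      Real.exp 14 * ((n.factorial : ℝ) ^ 6 / (2 * ((2 * n + 1).factorial : ℝ))) := by
  have ha : ‖a‖ ^ 2 ≤ 1 := by nlinarith [norm_nonneg b, pow_nonneg (norm_nonneg b) 4]
  have hb : ‖b‖ ^ 4 ≤ 1 := by nlinarith [norm_nonneg a, pow_nonneg (norm_nonneg a) 2]
  -- each factor
  have hR : ∀ m : ℕ, ‖((((m : ℂ) + 1) ^ 2 - a ^ 2) ^ 2 + 4 * b ^ 4) / (2 * ((m : ℂ) + 1) + 1)‖ ≤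
      ((m : ℝ) + 1) ^ 4 / (2 * ((m : ℝ) + 1) + 1) * (1 + 7 / ((m : ℝ) + 1) ^ 2) := by
    intro m
    have hy : (1 : ℝ) ≤ (m : ℝ) + 1 := by linarith [(m.cast_nonneg : (0 : ℝ) ≤ m)]
    have e3 : ‖(2 * ((m : ℂ) + 1) + 1)‖ = 2 * ((m : ℝ) + 1) + 1 := by
      rw [show (2 * ((m : ℂ) + 1) + 1) = ((2 * (m + 1) + 1 : ℕ) : ℂ) by push_cast; ring, Complex.norm_natCast]
      push_cast; ring
    have e2 : ‖((m : ℂ) + 1) ^ 2‖ = ((m : ℝ) + 1) ^ 2 := by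
      rw [show ((m : ℂ) + 1) = ((m + 1 : ℕ) : ℂ) by push_cast; ring, norm_pow, Complex.norm_natCast]; push_cast; ring
    have h1 : ‖((((m : ℂ) + 1) ^ 2 - a ^ 2) ^ 2 + 4 * b ^ 4)‖ ≤ (((m : ℝ) + 1) ^ 2 + ‖a‖ ^ 2) ^ 2 + 4 * ‖b‖ ^ 4 := by
      refine (norm_add_le _ _).trans ?_
      rw [norm_pow, norm_mul, norm_pow, show ‖(4 : ℂ)‖ = 4 by norm_num]
      gcongr
      refine (norm_sub_le _ _).trans ?_
      rw [e2, norm_pow]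
    rw [norm_div, e3, div_mul_eq_mul_div]
    apply div_le_div_of_nonneg_right _ (by positivity)
    refine h1.trans ?_
    have hm1 : ((m : ℝ) + 1) ≠ 0 := by positivity
    rw [show ((m : ℝ) + 1) ^ 4 * (1 + 7 / ((m : ℝ) + 1) ^ 2) = ((m : ℝ) + 1) ^ 4 + 7 * ((m : ℝ) + 1) ^ 2 by
      field_simp]
    nlinarith [pow_nonneg (norm_nonneg a) 2, pow_nonneg (norm_nonneg b) 4]
  -- the products
  have hexp : ∏ m ∈ range n, (1 + 7 / ((m : ℝ) + 1) ^ 2) ≤ Real.exp 14 := by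
    calc ∏ m ∈ range n, (1 + 7 / ((m : ℝ) + 1) ^ 2) ≤ ∏ m ∈ range n, Real.exp (7 / ((m : ℝ) + 1) ^ 2) :=
          prod_le_prod (fun m _ => by positivity) fun m _ => by
            rw [add_comm]; exact Real.add_one_le_exp _
      _ = Real.exp (∑ m ∈ range n, 7 / ((m : ℝ) + 1) ^ 2) := (Real.exp_sum _ _).symm
      _ ≤ Real.exp 14 := by
          refine Real.exp_le_exp.2 ?_
          have h := harm_two_le n
          calc ∑ m ∈ range n, 7 / ((m : ℝ) + 1) ^ 2 = 7 * ∑ m ∈ range n, 1 / ((m : ℝ) + 1) ^ 2 := by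
                rw [mul_sum]; exact sum_congr rfl fun m _ => by ring
            _ ≤ 7 * 2 := by gcongr
            _ = 14 := by norm_num
  have hodd : ∏ m ∈ range n, ((m : ℝ) + 1) ^ 4 / (2 * ((m : ℝ) + 1) + 1) =
      (n.factorial : ℝ) ^ 4 * (2 ^ n * (n.factorial : ℝ)) / ((2 * n + 1).factorial : ℝ) := by
    have e : ∏ m ∈ range n, ((m : ℝ) + 1) = (n.factorial : ℝ) := by
      rw [← Finset.prod_range_add_one_eq_factorial]; push_cast; rfl
    have hO : ∏ m ∈ range n, (2 * ((m : ℝ) + 1) + 1) ≠ 0 := prod_ne_zero_iff.2 fun m _ => by positivity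
    rw [prod_div_distrib, prod_pow, e, eq_div_iff (by positivity), ← two_pow_mul_factorial_mul_prod_odd_real n]
    field_simp
  rw [norm_mul, norm_div, norm_mul, norm_pow, norm_neg, norm_one, one_pow, one_mul, Complex.norm_natCast,
    norm_pow, show ‖(2 : ℂ)‖ = 2 by norm_num, norm_prod]
  calc (n.factorial : ℝ) / 2 ^ (n + 1) * ∏ m ∈ range n, ‖((((m : ℂ) + 1) ^ 2 - a ^ 2) ^ 2 + 4 * b ^ 4) / (2 * ((m : ℂ) + 1) + 1)‖
      ≤ (n.factorial : ℝ) / 2 ^ (n + 1) *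
          ∏ m ∈ range n, (((m : ℝ) + 1) ^ 4 / (2 * ((m : ℝ) + 1) + 1) * (1 + 7 / ((m : ℝ) + 1) ^ 2)) := by
        gcongr with m hm
        exact hR m
    _ = (n.factorial : ℝ) / 2 ^ (n + 1) * ((n.factorial : ℝ) ^ 4 * (2 ^ n * (n.factorial : ℝ)) / ((2 * n + 1).factorial : ℝ)) *
          ∏ m ∈ range n, (1 + 7 / ((m : ℝ) + 1) ^ 2) := by rw [prod_mul_distrib, hodd]; ring
    _ ≤ (n.factorial : ℝ) / 2 ^ (n + 1) * ((n.factorial : ℝ) ^ 4 * (2 ^ n * (n.factorial : ℝ)) / ((2 * n + 1).factorial : ℝ)) *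
          Real.exp 14 := by gcongr
    _ = Real.exp 14 * ((n.factorial : ℝ) ^ 6 / (2 * ((2 * n + 1).factorial : ℝ))) := by
        have h2 : (2 : ℝ) ^ (n + 1) = 2 ^ n * 2 := pow_succ 2 n
        rw [h2]; field_simp


end Literature.NumberTheory.ZetaValues
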